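import Summits.QuantumFields.BalabanUV.Beta.GAN24.EdgePotentialContourClimb

/-!
# `BalabanUV.Beta.GAN24.ChargeTowerExplicitPotential` — binder row G-an2-4 ∕ (CONV-C), the (S) row of RULING R-gan24p1-g27-1 PART B (viii), road-P2's (W-γ) CHARGE TOWER:
# **THE TOWER's POTENTIAL IS EXPLICIT — at every level `j+1` and every extra period `M`, the `Lc·M`-exit⊗exit charge function of `S_{j+1}` is
# `wVH_{j+1}·wΦ_{Lc^{j+1}}-image of (c·Π^ρ m̃^{Lc·M}_{αβ})` for a real `c`; at `M = 1`: `C_{j+1} = c_{j+1}·Δ_{j+1}(Π^ρ m̃^{Lc}_{αβ})`** — leaf-06 g48's Q-leaf06-g48-1 (i)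
# (ENGINE E29 (c): true at jb = 1 with `c_1 = A_1`), the input that lets FILES D∕E's (M3) cancellation run VERBATIM one level up (road-P2 chair `b2b-balaban-gan24-p2`, gen 43, INTENT 3 part 2)

NOT IN PRINT; OUR BOOKKEEPING ([folklore] MY g42 `ChargeTowerInduction` re-run with the potential carried explicitly: the base `exitCharge_srecAt_zero_eq_curvAdj_curv` ∕ `tower_zero` and the
rung `tower_succ` are COPIED with the `∃ m` replaced by the named potential; the one new input is part 1 `EdgePotentialContourClimb` (§3 the edge potential's image climbs by `Lc^{d+1}`,
§4 the image does not see `Π^ρ` inside `𝒬`); by name: leaf-02 PART B `tsum_prod_exitWt_srecAt_zero`, PART D `tsum_prod_exitWt_srecAt_eq_spureRecAt`, MY g41 `ChargeTowerClimb` §7 ∕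
`ChargeTowerClimbZero` §4 ∕ `ChargeTowerRegauge.tsum_sum_wΦ_mul_axProjAt_eq`, leaf-06 g46 `EdgePlaquettePotential` (`edgePotential_apply`, `abs_edgePotential_le_one`,
`curvAdj_curv_sub_dz`), MY g42 `curvAdj_curv_faceForm_eq_edgePotential ∕ exitWt_blk_eq ∕ staircase_forwardDiff`; 0 `def`, 0 cited fact, 0 `def … : Prop`, 0 sorry).
HONEST FRAMING (cell contract, verbatim): «discharging `BetaPertH` makes Bałaban's UV stability UNCONDITIONAL — a real constructive-QFT result; it is NOT the continuum limit and NOT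
the Clay problem.»  HONEST DEPENDENCY (verbatim): «continuum YM on T⁴ ⇐ BetaPertH ∧ nine spine estimates (0/9 proved); BetaPertH ⇐ (D1) ∧ (D4) ∧ CAP+tail; G-an2-4 gates asym, D1
and NE2/3/4.»
OBJECTS: in-block root `ρ = toSite r`; `m̃^L_{αβ}` = leaf-06's edge potential at scale `L` in CLOSED (ite) form `l x ↦ [l = α]·L⁻²·(x_β % L) − [l = β]·L⁻¹·𝟙[x_β % L = L−1]·(x_α % L)`
(`edgePotential_apply` = g46's `dz`-form); `C^{N}_{j+1}(κ,u) := Σ'_{(x,z)} 𝟙[x_α % N = N−1]·𝟙[z_β % N = N−1]·SpureRecAt … (j+1) κ u x z (inl α)(inl β)`.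
* §1 `tsum_sum_wΦ_mul_const_mul` (scalars leave the image), `abs_edgePotentialIte_le_one`.
* §2 **`exitCharge_srecAt_zero_eq_curvAdj_curv_explicit`** — MY g42 §3 base with the potential NAMED: the level-0 charge of the full member against the pulled-back weights is
  `d*d(Π^ρ((−cE∕2)·m̃^{Lc·(Lc·M)}))`.
* §3 **`tower_zero_explicit`** — the first rung with the potential named: `C^{Lc·M}_1 = wVH_1·wΦ_{Lc}-image of (c₀·Π^ρ m̃^{Lc·M})`, `c₀ = (cE·wE_1)·cH_0²·wVH_1⁻¹·(−cE∕2)·Lc^{d+1}`.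
* §4 **`tower_succ_explicit`** — the rung: IF `C^{Lc·(Lc·M)}_{j+1} = wVH_{j+1}·image(c·Π^ρ m̃^{Lc·(Lc·M)})` THEN `C^{Lc·M}_{j+2} = wVH_{j+2}·image(c′·Π^ρ m̃^{Lc·M})`,
  `c′ = (cE·wE_{j+2})·cH_{j+1}²·(stepScale_{j+1}∕wVH_{j+2})·Lc^{d+1}·c`.
* §5 **`tower_explicit`** (induction, `M ↦ Lc·M`): `∀ j, ∀ M ≥ 1, ∃ c, ∀ ν y′, C^{Lc·M}_{j+1}(ν,y′) = wVH_{j+1}·Σ'_v Σ_l wΦ_{Lc^{j+1}} ν l (y′−v)·(c·(Π^ρ m̃^{Lc·M}) l v)`;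
  **`exists_explicit_potential_exitCharge`** (`M = 1`, ite form) and **`exists_explicit_potential_exitCharge_dz`** (g46's `dz`-form, the shape FILE E's `n_{m̃}` mechanism consumes):
  THE exit⊗exit CHARGE FUNCTION OF `S_{j+1}` IS A MULTIPLE OF `Δ_{j+1}(Π^ρ m̃^{Lc}_{αβ})`, EVERY `j`.
READING.  `n_m` (FILE C §1) is linear in `m` and `Π^ρ ∘ Π^ρ = Π^ρ` is not even needed: the (M3) defect `⟨𝒬(σ_{1_B}⊙n_{c·Π^ρ m̃}), colM G_{j+1}(e)⟩ = c·⟨𝒬(σ_{1_B}⊙n_{Π^ρ m̃}), colM⟩`, and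
FILE D∕E's vanishing of the exit-slice defect of the edge potential is a statement about `m̃^{Lc}` alone — level-free.  Asserts NO value of any resolvent column; NOTHING of (W-γ)'s (γ) read
∕ (INV) ∕ (S) ∕ (Q-R) ∕ «T2Shape» ∕ (hW, hWall) discharged; NEVER «G-an2-4 closed» as (CONV-C); NOT D1, NOT `BetaPertH`, NOT continuum, NOT Clay.  2026-08-22; no existing file touched.
-/

noncomputable section

open Finset
open scoped BigOperators
open Literature.MathematicalPhysics.QuantumFieldTheory
open Literature.MathematicalPhysics.QuantumFieldTheory.Balaban1983to89
open Literature.MathematicalPhysics.QuantumFieldTheory.Balaban1983to89.Beta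
open ExpKernelCalculus (Site MKer)
open AffineAveraging (Form0 Form1 Form2 box toSite unitVec dz curv curvAdj contourSum)
open AveragingContours (blk)
open AveragingContoursRooted (treeGaugeAt)
open RootedComb (axProjAt axProjAt_apply)
open KernelSpecInstance (wΦ)
open OneStepResolventKernel (Fib)
open OneStepKernelFamily (KInvStep colH)
open BalabanStepJetsSucc (wVH wE)
open Summit.QuantumFields.BalabanUV.Beta.AxialDressingRooted (IsCombBondAt coDressKBmAt one_le_of_neZero axProjAt_eq_zero_of_isCombBond)
open Summit.QuantumFields.BalabanUV.Beta.BorderedHessian (stepScale)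
open Summit.QuantumFields.BalabanUV.Beta.SpineRooted (SpureRecAt)
open Summit.QuantumFields.BalabanUV.Beta.WardLocusRecursive (SrecAt)
open Summit.QuantumFields.BalabanUV.Beta.GAN24.EdgePlaquettePotential (edgePotential_apply abs_edgePotential_le_one curvAdj_curv_sub_dz)
open Summit.QuantumFields.BalabanUV.Beta.GAN24.EdgePotentialColumnOrthogonal (abs_axProjAt_le)
open Summit.QuantumFields.BalabanUV.Beta.GAN24.SrecChargeBlockPotentials (tsum_prod_exitWt_srecAt_zero)
open Summit.QuantumFields.BalabanUV.Beta.GAN24.SrecChargeLamDropsAllLevels (tsum_prod_exitWt_srecAt_eq_spureRecAt)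
open Summit.QuantumFields.BalabanUV.Beta.GAN24.ChargeTowerClimb (hasSum_prod_coordWeighted_SpureRecAt_of_exact_add_const)
open Summit.QuantumFields.BalabanUV.Beta.GAN24.ChargeTowerClimbZero (hasSum_prod_coordWeighted_SpureRecAt_one_of_exact_add_const)
open Summit.QuantumFields.BalabanUV.Beta.GAN24.ChargeTowerRegauge (tsum_sum_wΦ_mul_axProjAt_eq)
open Summit.QuantumFields.BalabanUV.Beta.GAN24.ChargeTowerInduction (exitWt_blk_eq abs_exitInd_le_one staircase_forwardDiff curvAdj_curv_faceForm_eq_edgePotential)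
open Summit.QuantumFields.BalabanUV.Beta.GAN24.EdgePotentialContourClimb (tsum_sum_wΦ_mul_contourSum_edgePotential tsum_sum_wΦ_mul_contourSum_axProjAt)

namespace Summit.QuantumFields.BalabanUV.Beta.GAN24.ChargeTowerExplicitPotential

variable {d : ℕ} {Lc : ℕ} [NeZero Lc] {r : Fin (d + 1) → ℕ}

/-! ## §1 Scalars leave the image; the closed-form edge potential is bounded by one -/

omit [NeZero Lc] in
/-- [folklore] A scalar factor leaves the value-Hessian image. -/
theorem tsum_sum_wΦ_mul_const_mul (M : ℕ) [NeZero M] (a : ℝ) (f : Form1 (d + 1) ℝ) (κ : Fin (d + 1)) (u : Site (d + 1)) :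
    ∑' v, ∑ l : Fin (d + 1), wΦ (N := M) κ l (u - v) * (a * f l v) = a * ∑' v, ∑ l : Fin (d + 1), wΦ (N := M) κ l (u - v) * f l v := by
  rw [← tsum_mul_left]
  refine tsum_congr fun v => ?_
  rw [Finset.mul_sum]
  exact Finset.sum_congr rfl fun l _ => by ring

omit [NeZero Lc] in
/-- [folklore] The closed-form edge potential is bounded by `1` (leaf-06's `abs_edgePotential_le_one` through `edgePotential_apply`). -/
theorem abs_edgePotentialIte_le_one {L : ℕ} (hL : 1 ≤ L) {α β : Fin (d + 1)} (hαβ : α ≠ β) (l : Fin (d + 1)) (x : Site (d + 1)) :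
    |(if l = α then ((L : ℝ) ^ 2)⁻¹ * (((x β % (L : ℤ) : ℤ)) : ℝ) else 0)
        - (if l = β then (L : ℝ)⁻¹ * (if x β % (L : ℤ) = (L : ℤ) - 1 then (1 : ℝ) else 0) * (((x α % (L : ℤ) : ℤ)) : ℝ) else 0)| ≤ 1 := by
  rw [← edgePotential_apply hL hαβ l x]
  exact abs_edgePotential_le_one hL hαβ l x

/-! ## §2 The base with the potential named -/

/-- NOT IN PRINT; OUR BOOKKEEPING.  **MY g42 `exitCharge_srecAt_zero_eq_curvAdj_curv` WITH THE POTENTIAL NAMED** (in-block root, `α ≠ β`, all `cE cVH cΛ`, `M ≥ 1`): the level-0 charge of the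
full member against `𝟙^{exit,Lc}·𝟙^{exit,Lc·M}(blk) ⊗ (same)` is `1·d*d(Π^ρ((−cE∕2)·m̃^{Lc·(Lc·M)}_{αβ})) + 0` with the edge potential in CLOSED form — PART B ⨾ the base junction ⨾
`edgePotential_apply` ⨾ `curvAdj_curv_sub_dz`. -/
theorem exitCharge_srecAt_zero_eq_curvAdj_curv_explicit (hr : r ∈ box (d + 1) Lc) (cE cVH cΛ : ℝ) {α β : Fin (d + 1)} (hαβ : α ≠ β) {M : ℕ} (hM : 1 ≤ M) :
    ∀ (κ : Fin (d + 1)) (u : Site (d + 1)), ∑' xz : Site (d + 1) × Site (d + 1),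
        (if xz.1 α % (Lc : ℤ) = (Lc : ℤ) - 1 then (if blk Lc xz.1 α % ((Lc * M : ℕ) : ℤ) = ((Lc * M : ℕ) : ℤ) - 1 then (1 : ℝ) else 0) else 0)
          * (if xz.2 β % (Lc : ℤ) = (Lc : ℤ) - 1 then (if blk Lc xz.2 β % ((Lc * M : ℕ) : ℤ) = ((Lc * M : ℕ) : ℤ) - 1 then (1 : ℝ) else 0) else 0)
          * SrecAt d Lc (toSite r) cE cVH cΛ 0 κ u xz.1 xz.2 (Sum.inl α) (Sum.inl β)
        = 1 * curvAdj (curv (axProjAt (toSite r) Lc (fun l z => (-(cE / 2))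
            * ((if l = α then ((((Lc * (Lc * M) : ℕ) : ℝ)) ^ 2)⁻¹ * (((z β % ((Lc * (Lc * M) : ℕ) : ℤ) : ℤ)) : ℝ) else 0)
              - (if l = β then (((Lc * (Lc * M) : ℕ) : ℝ))⁻¹ * (if z β % ((Lc * (Lc * M) : ℕ) : ℤ) = ((Lc * (Lc * M) : ℕ) : ℤ) - 1 then (1 : ℝ) else 0)
                  * (((z α % ((Lc * (Lc * M) : ℕ) : ℤ) : ℤ)) : ℝ) else 0))))) κ u + (fun _ : Fin (d + 1) => (0 : ℝ)) κ := by
  classical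
  intro κ u
  have hLc : 1 ≤ Lc := one_le_of_neZero Lc
  have hLc0 : (0 : ℤ) ≤ Lc := by exact_mod_cast (Nat.zero_le Lc)
  have hLM : 1 ≤ Lc * M := Nat.one_le_iff_ne_zero.2 (Nat.mul_ne_zero (by omega) (by omega))
  have hL : 1 ≤ Lc * (Lc * M) := Nat.one_le_iff_ne_zero.2 (Nat.mul_ne_zero (by omega) (by omega))
  -- PART B with the staircase primitives
  have hF : ∀ t : ℤ, (((((t + 1) / ((Lc * M : ℕ) : ℤ) : ℤ)) : ℝ)) - (((t / ((Lc * M : ℕ) : ℤ) : ℤ)) : ℝ)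
      = if t % ((Lc * M : ℕ) : ℤ) = ((Lc * M : ℕ) : ℤ) - 1 then (1 : ℝ) else 0 := staircase_forwardDiff hLM
  have hB := tsum_prod_exitWt_srecAt_zero hLc hr cE cVH cΛ (F₁ := fun t : ℤ => (((t / ((Lc * M : ℕ) : ℤ) : ℤ)) : ℝ))
    (F₂ := fun t : ℤ => (((t / ((Lc * M : ℕ) : ℤ) : ℤ)) : ℝ)) hF hF (fun s => abs_exitInd_le_one _ s) (fun s => abs_exitInd_le_one _ s) κ u α β
  rw [hB, one_mul, add_zero]
  -- the potential of PART B is `(−cE∕4)`× the face form at scale `L`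
  have epot : (fun β' z => (-(cE / 4)) * (dz (fun w : Fin (d + 1) → ℤ => (((w β / (Lc : ℤ) / ((Lc * M : ℕ) : ℤ) : ℤ)) : ℝ)) β' z
        * ((((z α / (Lc : ℤ) / ((Lc * M : ℕ) : ℤ) : ℤ)) : ℝ) + (((z + B6BondElimination.unitVec β') α / (Lc : ℤ) / ((Lc * M : ℕ) : ℤ) : ℤ) : ℝ))))
      = fun β' z => (-(cE / 4)) * (dz (fun w : Fin (d + 1) → ℤ => (((w β / ((Lc * (Lc * M) : ℕ) : ℤ) : ℤ)) : ℝ)) β' z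
        * ((((z α / ((Lc * (Lc * M) : ℕ) : ℤ) : ℤ)) : ℝ) + (((z + B6BondElimination.unitVec β') α / ((Lc * (Lc * M) : ℕ) : ℤ) : ℤ) : ℝ))) := by
    funext β' z
    simp only [Int.ediv_ediv_of_nonneg hLc0, Nat.cast_mul]
  rw [epot, curvAdj_curv_faceForm_eq_edgePotential hL hαβ cE κ u]
  -- the closed form of the edge potential, and `d*d` does not see the hard-axial gauge representative
  have eite : (fun l z => (-(cE / 2))
            * ((if l = α then ((((Lc * (Lc * M) : ℕ) : ℝ)) ^ 2)⁻¹ * (((z β % ((Lc * (Lc * M) : ℕ) : ℤ) : ℤ)) : ℝ) else 0)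
              - (if l = β then (((Lc * (Lc * M) : ℕ) : ℝ))⁻¹ * (if z β % ((Lc * (Lc * M) : ℕ) : ℤ) = ((Lc * (Lc * M) : ℕ) : ℤ) - 1 then (1 : ℝ) else 0)
                  * (((z α % ((Lc * (Lc * M) : ℕ) : ℤ) : ℤ)) : ℝ) else 0)))
      = fun l z => (-(cE / 2)) * (((((Lc * (Lc * M) : ℕ) : ℝ)) ^ 2)⁻¹ * ((((z + unitVec l) β % ((Lc * (Lc * M) : ℕ) : ℤ) : ℤ)) : ℝ)
          * dz (fun w : Fin (d + 1) → ℤ => ((w α : ℤ) : ℝ)) l z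
        - (((Lc * (Lc * M) : ℕ) : ℝ))⁻¹ * (((z α % ((Lc * (Lc * M) : ℕ) : ℤ) : ℤ)) : ℝ)
          * dz (fun w : Fin (d + 1) → ℤ => (((w β / ((Lc * (Lc * M) : ℕ) : ℤ) : ℤ)) : ℝ)) l z) := by
    funext l z
    rw [edgePotential_apply hL hαβ l z]
  rw [eite]
  set n : Form1 (d + 1) ℝ := fun l z => (-(cE / 2)) * (((((Lc * (Lc * M) : ℕ) : ℝ)) ^ 2)⁻¹ * ((((z + unitVec l) β % ((Lc * (Lc * M) : ℕ) : ℤ) : ℤ)) : ℝ)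
      * dz (fun w : Fin (d + 1) → ℤ => ((w α : ℤ) : ℝ)) l z
    - (((Lc * (Lc * M) : ℕ) : ℝ))⁻¹ * (((z α % ((Lc * (Lc * M) : ℕ) : ℤ) : ℤ)) : ℝ)
      * dz (fun w : Fin (d + 1) → ℤ => (((w β / ((Lc * (Lc * M) : ℕ) : ℤ) : ℤ)) : ℝ)) l z) with hn
  have e0 : axProjAt (toSite r) Lc n = fun l z => n l z - dz (treeGaugeAt (toSite r) n Lc) l z := by
    funext l z
    rw [axProjAt_apply]
    rfl
  rw [e0, curvAdj_curv_sub_dz]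

/-! ## §3 The first rung with the potential named -/

/-- NOT IN PRINT; OUR BOOKKEEPING.  **THE FIRST RUNG, EXPLICIT** (in-block root, `α ≠ β`, all `cE cVH cΛ`, `M ≥ 1`): the `Lc·M`-exit⊗exit charge function of `S_1` is
`wVH_1·wΦ_{Lc}-image of (c₀·Π^ρ m̃^{Lc·M}_{αβ})`, `c₀ = (cE·wE_1)·cH_0²·((1∕wVH_1)·(−cE∕2)·Lc^{d+1})` — MY g42 `tower_zero` (ClimbZero §4, `a = 1`, `c = 0`, on §2) with the climbed
potential `wVH_1⁻¹·𝒬_{Lc}(Π^ρ((−cE∕2)·m̃^{Lc·(Lc·M)}))` SIMPLIFIED inside the image by part 1: `Π^ρ` dropped (§4), the edge potential descended (§3), `Π^ρ` restored (`tsum_sum_wΦ_mul_axProjAt_eq`). -/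
theorem tower_zero_explicit (hr : r ∈ box (d + 1) Lc) (cE cVH cΛ : ℝ) {α β : Fin (d + 1)} (hαβ : α ≠ β) {M : ℕ} (hM : 1 ≤ M)
    (ν : Fin (d + 1)) (y' : Site (d + 1)) :
    ∑' xz : Site (d + 1) × Site (d + 1),
        (if xz.1 α % ((Lc * M : ℕ) : ℤ) = ((Lc * M : ℕ) : ℤ) - 1 then (1 : ℝ) else 0) * (if xz.2 β % ((Lc * M : ℕ) : ℤ) = ((Lc * M : ℕ) : ℤ) - 1 then (1 : ℝ) else 0)
          * SpureRecAt d Lc (toSite r) cE cVH cΛ (0 + 1) ν y' xz.1 xz.2 (Sum.inl α) (Sum.inl β)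
      = wVH d Lc (0 + 1) * ∑' v, ∑ l : Fin (d + 1), wΦ (N := Lc ^ (0 + 1)) ν l (y' - v)
          * (((cE * wE d Lc 1) * ((stepScale d Lc 0 * (Lc : ℝ) ^ (d + 1))⁻¹ ^ 2) * ((1 / wVH d Lc (0 + 1)) * (-(cE / 2)) * (Lc : ℝ) ^ (d + 1)))
            * axProjAt (toSite r) Lc (fun l x => (if l = α then ((((Lc * M : ℕ) : ℝ)) ^ 2)⁻¹ * (((x β % ((Lc * M : ℕ) : ℤ) : ℤ)) : ℝ) else 0)
              - (if l = β then (((Lc * M : ℕ) : ℝ))⁻¹ * (if x β % ((Lc * M : ℕ) : ℤ) = ((Lc * M : ℕ) : ℤ) - 1 then (1 : ℝ) else 0) * (((x α % ((Lc * M : ℕ) : ℤ) : ℤ)) : ℝ) else 0)) l v) := by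
  classical
  have hLc : 1 ≤ Lc := one_le_of_neZero Lc
  have hLM : 1 ≤ Lc * M := Nat.one_le_iff_ne_zero.2 (Nat.mul_ne_zero (by omega) (by omega))
  have hL : 1 ≤ Lc * (Lc * M) := Nat.one_le_iff_ne_zero.2 (Nat.mul_ne_zero (by omega) (by omega))
  have hC := exitCharge_srecAt_zero_eq_curvAdj_curv_explicit hr cE cVH cΛ hαβ hM
  -- the scaled edge potential at scale `Lc·(Lc·M)` and its bound
  set n : Form1 (d + 1) ℝ := fun l z => (-(cE / 2))
            * ((if l = α then ((((Lc * (Lc * M) : ℕ) : ℝ)) ^ 2)⁻¹ * (((z β % ((Lc * (Lc * M) : ℕ) : ℤ) : ℤ)) : ℝ) else 0)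
              - (if l = β then (((Lc * (Lc * M) : ℕ) : ℝ))⁻¹ * (if z β % ((Lc * (Lc * M) : ℕ) : ℤ) = ((Lc * (Lc * M) : ℕ) : ℤ) - 1 then (1 : ℝ) else 0)
                  * (((z α % ((Lc * (Lc * M) : ℕ) : ℤ) : ℤ)) : ℝ) else 0)) with hn
  have hnB : ∀ l z, |n l z| ≤ |cE / 2| * 1 := fun l z => by
    simp only [hn]
    rw [abs_mul, abs_neg]
    exact mul_le_mul_of_nonneg_left (abs_edgePotentialIte_le_one hL hαβ l z) (abs_nonneg _)
  have hPiB : ∀ l z, |axProjAt (toSite r) Lc n l z| ≤ |cE / 2| * 1 + 2 * ((((d + 1 : ℕ) : ℝ)) * Lc * (|cE / 2| * 1)) := fun l z => abs_axProjAt_le hLc hr hnB l z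
  have hPi0 : ∀ l z, IsCombBondAt (toSite r) Lc l z → axProjAt (toSite r) Lc n l z = 0 := fun l z h => axProjAt_eq_zero_of_isCombBond h _
  -- `ChargeTowerClimbZero` §4 with `a = 1`, `c = 0`
  have h4 := hasSum_prod_coordWeighted_SpureRecAt_one_of_exact_add_const hr cE cVH cΛ α β
    (fun s : ℤ => if s % ((Lc * M : ℕ) : ℤ) = ((Lc * M : ℕ) : ℤ) - 1 then (1 : ℝ) else 0)
    (fun s : ℤ => if s % ((Lc * M : ℕ) : ℤ) = ((Lc * M : ℕ) : ℤ) - 1 then (1 : ℝ) else 0)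
    (fun s => abs_exitInd_le_one _ s) (fun s => abs_exitInd_le_one _ s) hPiB hPi0 1 (fun _ => (0 : ℝ)) hC ν y'
  rw [h4.tsum_eq, zero_mul, add_zero]
  -- simplify the climbed potential inside the image
  have hEb : ∀ (l : Fin (d + 1)) (v : Site (d + 1)), |(if l = α then ((((Lc * M : ℕ) : ℝ)) ^ 2)⁻¹ * (((v β % ((Lc * M : ℕ) : ℤ) : ℤ)) : ℝ) else 0)
      - (if l = β then (((Lc * M : ℕ) : ℝ))⁻¹ * (if v β % ((Lc * M : ℕ) : ℤ) = ((Lc * M : ℕ) : ℤ) - 1 then (1 : ℝ) else 0) * (((v α % ((Lc * M : ℕ) : ℤ) : ℤ)) : ℝ) else 0)| ≤ 1 :=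
    fun l v => abs_edgePotentialIte_le_one hLM hαβ l v
  have himg : (∑' y, ∑ κ : Fin (d + 1), wΦ (N := Lc ^ (0 + 1)) ν κ (y' - y) * ((1 / wVH d Lc (0 + 1)) * contourSum Lc (axProjAt (toSite r) Lc n) κ y))
      = (1 / wVH d Lc (0 + 1)) * ((-(cE / 2)) * ((Lc : ℝ) ^ (d + 1) * ∑' y, ∑ κ : Fin (d + 1), wΦ (N := Lc ^ (0 + 1)) ν κ (y' - y)
          * axProjAt (toSite r) Lc (fun l x => (if l = α then ((((Lc * M : ℕ) : ℝ)) ^ 2)⁻¹ * (((x β % ((Lc * M : ℕ) : ℤ) : ℤ)) : ℝ) else 0)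
              - (if l = β then (((Lc * M : ℕ) : ℝ))⁻¹ * (if x β % ((Lc * M : ℕ) : ℤ) = ((Lc * M : ℕ) : ℤ) - 1 then (1 : ℝ) else 0) * (((x α % ((Lc * M : ℕ) : ℤ) : ℤ)) : ℝ) else 0)) κ y)) := by
    rw [tsum_sum_wΦ_mul_const_mul, tsum_sum_wΦ_mul_contourSum_axProjAt (Lc ^ (0 + 1)) hLc hr hnB ν y']
    have e1 : ∀ (κ : Fin (d + 1)) (y : Site (d + 1)), contourSum Lc n κ y = (-(cE / 2)) * contourSum Lc (fun l z =>
        (if l = α then ((((Lc * (Lc * M) : ℕ) : ℝ)) ^ 2)⁻¹ * (((z β % ((Lc * (Lc * M) : ℕ) : ℤ) : ℤ)) : ℝ) else 0)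
          - (if l = β then (((Lc * (Lc * M) : ℕ) : ℝ))⁻¹ * (if z β % ((Lc * (Lc * M) : ℕ) : ℤ) = ((Lc * (Lc * M) : ℕ) : ℤ) - 1 then (1 : ℝ) else 0)
              * (((z α % ((Lc * (Lc * M) : ℕ) : ℤ) : ℤ)) : ℝ) else 0)) κ y := fun κ y => ResolventComposition.contourSum_const_mul _ _ κ y
    simp only [e1]
    rw [tsum_sum_wΦ_mul_const_mul, tsum_sum_wΦ_mul_contourSum_edgePotential (Lc ^ (0 + 1)) hLc hLM hαβ ν y', ← tsum_sum_wΦ_mul_axProjAt_eq (Lc ^ (0 + 1)) hr hEb ν y']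
  rw [himg, tsum_sum_wΦ_mul_const_mul]
  ring

/-! ## §4 The rung with the potential named -/

/-- NOT IN PRINT; OUR BOOKKEEPING.  **THE RUNG `j+1 → j+2`, EXPLICIT** (in-block root, `α ≠ β`, all `cE cVH cΛ`, `M ≥ 1`, any real `c`): IF the `Lc·(Lc·M)`-exit⊗exit charge function of
`S_{j+1}` is `wVH_{j+1}·image(c·Π^ρ m̃^{Lc·(Lc·M)})` THEN the `Lc·M`-one of `S_{j+2}` is `wVH_{j+2}·image(c′·Π^ρ m̃^{Lc·M})`, `c′ = (cE·wE_{j+2})·cH_{j+1}²·((stepScale_{j+1}∕wVH_{j+2})·c·Lc^{d+1})`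
— MY g42 `tower_succ` (PART D ⨾ (W) ⨾ `ChargeTowerClimb` §7) with the climbed potential simplified inside the image by part 1. -/
theorem tower_succ_explicit (hr : r ∈ box (d + 1) Lc) (cE cVH cΛ : ℝ) {α β : Fin (d + 1)} (hαβ : α ≠ β) (j : ℕ) {M : ℕ} (hM : 1 ≤ M) (c : ℝ)
    (hT : ∀ (κ : Fin (d + 1)) (u : Site (d + 1)), ∑' xz : Site (d + 1) × Site (d + 1),
        (if xz.1 α % ((Lc * (Lc * M) : ℕ) : ℤ) = ((Lc * (Lc * M) : ℕ) : ℤ) - 1 then (1 : ℝ) else 0)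
          * (if xz.2 β % ((Lc * (Lc * M) : ℕ) : ℤ) = ((Lc * (Lc * M) : ℕ) : ℤ) - 1 then (1 : ℝ) else 0)
          * SpureRecAt d Lc (toSite r) cE cVH cΛ (j + 1) κ u xz.1 xz.2 (Sum.inl α) (Sum.inl β)
        = wVH d Lc (j + 1) * ∑' v, ∑ l : Fin (d + 1), wΦ (N := Lc ^ (j + 1)) κ l (u - v)
          * (c * axProjAt (toSite r) Lc (fun l x => (if l = α then ((((Lc * (Lc * M) : ℕ) : ℝ)) ^ 2)⁻¹ * (((x β % ((Lc * (Lc * M) : ℕ) : ℤ) : ℤ)) : ℝ) else 0)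
              - (if l = β then (((Lc * (Lc * M) : ℕ) : ℝ))⁻¹ * (if x β % ((Lc * (Lc * M) : ℕ) : ℤ) = ((Lc * (Lc * M) : ℕ) : ℤ) - 1 then (1 : ℝ) else 0)
                  * (((x α % ((Lc * (Lc * M) : ℕ) : ℤ) : ℤ)) : ℝ) else 0)) l v))
    (ν : Fin (d + 1)) (y' : Site (d + 1)) :
    ∑' xz : Site (d + 1) × Site (d + 1),
        (if xz.1 α % ((Lc * M : ℕ) : ℤ) = ((Lc * M : ℕ) : ℤ) - 1 then (1 : ℝ) else 0) * (if xz.2 β % ((Lc * M : ℕ) : ℤ) = ((Lc * M : ℕ) : ℤ) - 1 then (1 : ℝ) else 0)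
          * SpureRecAt d Lc (toSite r) cE cVH cΛ (j + 2) ν y' xz.1 xz.2 (Sum.inl α) (Sum.inl β)
      = wVH d Lc (j + 2) * ∑' v, ∑ l : Fin (d + 1), wΦ (N := Lc ^ (j + 2)) ν l (y' - v)
          * (((cE * wE d Lc (j + 2)) * ((stepScale d Lc (j + 1) * (Lc : ℝ) ^ (d + 1))⁻¹ ^ 2) * ((stepScale d Lc (j + 1) / wVH d Lc (j + 2)) * c * (Lc : ℝ) ^ (d + 1)))
            * axProjAt (toSite r) Lc (fun l x => (if l = α then ((((Lc * M : ℕ) : ℝ)) ^ 2)⁻¹ * (((x β % ((Lc * M : ℕ) : ℤ) : ℤ)) : ℝ) else 0)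
              - (if l = β then (((Lc * M : ℕ) : ℝ))⁻¹ * (if x β % ((Lc * M : ℕ) : ℤ) = ((Lc * M : ℕ) : ℤ) - 1 then (1 : ℝ) else 0) * (((x α % ((Lc * M : ℕ) : ℤ) : ℤ)) : ℝ) else 0)) l v) := by
  classical
  have hLc : 1 ≤ Lc := one_le_of_neZero Lc
  have hLM : 1 ≤ Lc * M := Nat.one_le_iff_ne_zero.2 (Nat.mul_ne_zero (by omega) (by omega))
  have hL : 1 ≤ Lc * (Lc * M) := Nat.one_le_iff_ne_zero.2 (Nat.mul_ne_zero (by omega) (by omega))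
  -- the hypothesis' potential: bounded and comb-gauged
  set E : Form1 (d + 1) ℝ := fun l x => (if l = α then ((((Lc * (Lc * M) : ℕ) : ℝ)) ^ 2)⁻¹ * (((x β % ((Lc * (Lc * M) : ℕ) : ℤ) : ℤ)) : ℝ) else 0)
      - (if l = β then (((Lc * (Lc * M) : ℕ) : ℝ))⁻¹ * (if x β % ((Lc * (Lc * M) : ℕ) : ℤ) = ((Lc * (Lc * M) : ℕ) : ℤ) - 1 then (1 : ℝ) else 0)
          * (((x α % ((Lc * (Lc * M) : ℕ) : ℤ) : ℤ)) : ℝ) else 0) with hE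
  have hEb' : ∀ l x, |E l x| ≤ 1 := fun l x => abs_edgePotentialIte_le_one hL hαβ l x
  have hPiB : ∀ l z, |axProjAt (toSite r) Lc E l z| ≤ 1 + 2 * ((((d + 1 : ℕ) : ℝ)) * Lc * 1) := fun l z => abs_axProjAt_le hLc hr hEb' l z
  have hmB : ∀ l z, |c * axProjAt (toSite r) Lc E l z| ≤ |c| * (1 + 2 * ((((d + 1 : ℕ) : ℝ)) * Lc * 1)) := fun l z => by
    rw [abs_mul]; exact mul_le_mul_of_nonneg_left (hPiB l z) (abs_nonneg _)
  have hm0 : ∀ l z, IsCombBondAt (toSite r) Lc l z → c * axProjAt (toSite r) Lc E l z = 0 := fun l z h => by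
    rw [axProjAt_eq_zero_of_isCombBond h _, mul_zero]
  -- the hypothesis `hC` of `ChargeTowerClimb` §7 on the FULL member: PART D ⨾ (W) ⨾ `hT`
  have hC : ∀ (κ : Fin (d + 1)) (u : Site (d + 1)), ∑' yw : Site (d + 1) × Site (d + 1),
      (if yw.1 α % (Lc : ℤ) = (Lc : ℤ) - 1 then (if blk Lc yw.1 α % ((Lc * M : ℕ) : ℤ) = ((Lc * M : ℕ) : ℤ) - 1 then (1 : ℝ) else 0) else 0)
        * (if yw.2 β % (Lc : ℤ) = (Lc : ℤ) - 1 then (if blk Lc yw.2 β % ((Lc * M : ℕ) : ℤ) = ((Lc * M : ℕ) : ℤ) - 1 then (1 : ℝ) else 0) else 0)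
        * SrecAt d Lc (toSite r) cE cVH cΛ (j + 1) κ u yw.1 yw.2 (Sum.inl α) (Sum.inl β)
      = (wVH d Lc (j + 1) * ∑' v, ∑ l : Fin (d + 1), wΦ (N := Lc ^ (j + 1)) κ l (u - v) * (fun l v => c * axProjAt (toSite r) Lc E l v) l v)
        + (fun _ : Fin (d + 1) => (0 : ℝ)) κ := by
    intro κ u
    have hD := tsum_prod_exitWt_srecAt_eq_spureRecAt hLc hr cE cVH cΛ (j + 1)
      (f₁ := fun s : ℤ => if s % ((Lc * M : ℕ) : ℤ) = ((Lc * M : ℕ) : ℤ) - 1 then (1 : ℝ) else 0)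
      (f₂ := fun s : ℤ => if s % ((Lc * M : ℕ) : ℤ) = ((Lc * M : ℕ) : ℤ) - 1 then (1 : ℝ) else 0)
      (fun s => abs_exitInd_le_one _ s) (fun s => abs_exitInd_le_one _ s) κ u α β
    rw [hD, add_zero, ← hT κ u]
    refine tsum_congr fun yw => ?_
    rw [exitWt_blk_eq hLc hLM yw.1 α, exitWt_blk_eq hLc hLM yw.2 β]
  -- `ChargeTowerClimb` §7 with `c = 0`
  have h7 := hasSum_prod_coordWeighted_SpureRecAt_of_exact_add_const hr cE cVH cΛ j α β
    (fun s : ℤ => if s % ((Lc * M : ℕ) : ℤ) = ((Lc * M : ℕ) : ℤ) - 1 then (1 : ℝ) else 0)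
    (fun s : ℤ => if s % ((Lc * M : ℕ) : ℤ) = ((Lc * M : ℕ) : ℤ) - 1 then (1 : ℝ) else 0)
    (fun s => abs_exitInd_le_one _ s) (fun s => abs_exitInd_le_one _ s) hmB hm0 (fun _ => (0 : ℝ)) hC ν y'
  rw [h7.tsum_eq, zero_mul, add_zero]
  -- simplify the climbed potential inside the image
  have hEb : ∀ (l : Fin (d + 1)) (v : Site (d + 1)), |(if l = α then ((((Lc * M : ℕ) : ℝ)) ^ 2)⁻¹ * (((v β % ((Lc * M : ℕ) : ℤ) : ℤ)) : ℝ) else 0)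
      - (if l = β then (((Lc * M : ℕ) : ℝ))⁻¹ * (if v β % ((Lc * M : ℕ) : ℤ) = ((Lc * M : ℕ) : ℤ) - 1 then (1 : ℝ) else 0) * (((v α % ((Lc * M : ℕ) : ℤ) : ℤ)) : ℝ) else 0)| ≤ 1 :=
    fun l v => abs_edgePotentialIte_le_one hLM hαβ l v
  have himg : (∑' y, ∑ κ : Fin (d + 1), wΦ (N := Lc ^ (j + 2)) ν κ (y' - y)
        * ((stepScale d Lc (j + 1) / wVH d Lc (j + 2)) * contourSum Lc (fun l v => c * axProjAt (toSite r) Lc E l v) κ y))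
      = (stepScale d Lc (j + 1) / wVH d Lc (j + 2)) * (c * ((Lc : ℝ) ^ (d + 1) * ∑' y, ∑ κ : Fin (d + 1), wΦ (N := Lc ^ (j + 2)) ν κ (y' - y)
          * axProjAt (toSite r) Lc (fun l x => (if l = α then ((((Lc * M : ℕ) : ℝ)) ^ 2)⁻¹ * (((x β % ((Lc * M : ℕ) : ℤ) : ℤ)) : ℝ) else 0)
              - (if l = β then (((Lc * M : ℕ) : ℝ))⁻¹ * (if x β % ((Lc * M : ℕ) : ℤ) = ((Lc * M : ℕ) : ℤ) - 1 then (1 : ℝ) else 0) * (((x α % ((Lc * M : ℕ) : ℤ) : ℤ)) : ℝ) else 0)) κ y)) := by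
    rw [tsum_sum_wΦ_mul_const_mul]
    have e1 : ∀ (κ : Fin (d + 1)) (y : Site (d + 1)), contourSum Lc (fun l v => c * axProjAt (toSite r) Lc E l v) κ y = c * contourSum Lc (axProjAt (toSite r) Lc E) κ y :=
      fun κ y => ResolventComposition.contourSum_const_mul _ _ κ y
    simp only [e1]
    rw [tsum_sum_wΦ_mul_const_mul, tsum_sum_wΦ_mul_contourSum_axProjAt (Lc ^ (j + 2)) hLc hr hEb' ν y']
    simp only [hE]
    rw [tsum_sum_wΦ_mul_contourSum_edgePotential (Lc ^ (j + 2)) hLc hLM hαβ ν y', ← tsum_sum_wΦ_mul_axProjAt_eq (Lc ^ (j + 2)) hr hEb ν y']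
  rw [himg, tsum_sum_wΦ_mul_const_mul]
  ring

/-! ## §5 The explicit tower and the `M = 1` corollaries -/

/-- NOT IN PRINT; OUR BOOKKEEPING.  **THE CHARGE TOWER WITH ITS POTENTIAL NAMED, EVERY LEVEL, EVERY EXTRA PERIOD** (in-block root, `α ≠ β`, all `cE cVH cΛ`; induction on `j` with
`M ↦ Lc·M`: base §3, rung §4): for every `j` and every `M ≥ 1` there is a REAL `c` with
`∀ ν y′, C^{Lc·M}_{j+1}(ν,y′) = wVH_{j+1}·Σ'_v Σ_l wΦ_{Lc^{j+1}} ν l (y′ − v)·(c·(Π^ρ m̃^{Lc·M}_{αβ}) l v)` — the tower's potential IS a multiple of the hard-axial edge potential. -/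
theorem tower_explicit (hr : r ∈ box (d + 1) Lc) (cE cVH cΛ : ℝ) {α β : Fin (d + 1)} (hαβ : α ≠ β) (j : ℕ) :
    ∀ {M : ℕ}, 1 ≤ M → ∃ c : ℝ, ∀ (ν : Fin (d + 1)) (y' : Site (d + 1)), ∑' xz : Site (d + 1) × Site (d + 1),
        (if xz.1 α % ((Lc * M : ℕ) : ℤ) = ((Lc * M : ℕ) : ℤ) - 1 then (1 : ℝ) else 0) * (if xz.2 β % ((Lc * M : ℕ) : ℤ) = ((Lc * M : ℕ) : ℤ) - 1 then (1 : ℝ) else 0)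
          * SpureRecAt d Lc (toSite r) cE cVH cΛ (j + 1) ν y' xz.1 xz.2 (Sum.inl α) (Sum.inl β)
      = wVH d Lc (j + 1) * ∑' v, ∑ l : Fin (d + 1), wΦ (N := Lc ^ (j + 1)) ν l (y' - v)
          * (c * axProjAt (toSite r) Lc (fun l x => (if l = α then ((((Lc * M : ℕ) : ℝ)) ^ 2)⁻¹ * (((x β % ((Lc * M : ℕ) : ℤ) : ℤ)) : ℝ) else 0)
              - (if l = β then (((Lc * M : ℕ) : ℝ))⁻¹ * (if x β % ((Lc * M : ℕ) : ℤ) = ((Lc * M : ℕ) : ℤ) - 1 then (1 : ℝ) else 0) * (((x α % ((Lc * M : ℕ) : ℤ) : ℤ)) : ℝ) else 0)) l v) := by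
  induction j with
  | zero => exact fun hM => ⟨_, fun ν y' => tower_zero_explicit hr cE cVH cΛ hαβ hM ν y'⟩
  | succ j ih =>
    intro M hM
    have hLM : 1 ≤ Lc * M := Nat.one_le_iff_ne_zero.2 (Nat.mul_ne_zero (NeZero.ne Lc) (by omega))
    obtain ⟨c, hT⟩ := ih hLM
    exact ⟨_, fun ν y' => tower_succ_explicit hr cE cVH cΛ hαβ j hM c hT ν y'⟩

/-- NOT IN PRINT; OUR BOOKKEEPING.  **THE exit⊗exit CHARGE FUNCTION OF `S_{j+1}` IS A MULTIPLE OF `Δ_{j+1}(Π^ρ m̃^{Lc}_{αβ})`, EVERY LEVEL** (`M = 1`; closed form of the edge potential):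
`∃ c, ∀ ν y′, C_{j+1}(ν,y′) = wVH_{j+1}·Σ'_v Σ_l wΦ_{Lc^{j+1}} ν l (y′ − v)·(c·(Π^ρ m̃^{Lc}_{αβ}) l v)` — leaf-06 g48 Q-leaf06-g48-1 (i) (ENGINE E29 (c): `c_1 = A_1`). -/
theorem exists_explicit_potential_exitCharge (hr : r ∈ box (d + 1) Lc) (cE cVH cΛ : ℝ) {α β : Fin (d + 1)} (hαβ : α ≠ β) (j : ℕ) :
    ∃ c : ℝ, ∀ (ν : Fin (d + 1)) (y' : Site (d + 1)), ∑' xz : Site (d + 1) × Site (d + 1),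
        (if xz.1 α % (Lc : ℤ) = (Lc : ℤ) - 1 then (1 : ℝ) else 0) * (if xz.2 β % (Lc : ℤ) = (Lc : ℤ) - 1 then (1 : ℝ) else 0)
          * SpureRecAt d Lc (toSite r) cE cVH cΛ (j + 1) ν y' xz.1 xz.2 (Sum.inl α) (Sum.inl β)
      = wVH d Lc (j + 1) * ∑' v, ∑ l : Fin (d + 1), wΦ (N := Lc ^ (j + 1)) ν l (y' - v)
          * (c * axProjAt (toSite r) Lc (fun l x => (if l = α then ((Lc : ℝ) ^ 2)⁻¹ * (((x β % (Lc : ℤ) : ℤ)) : ℝ) else 0)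
              - (if l = β then (Lc : ℝ)⁻¹ * (if x β % (Lc : ℤ) = (Lc : ℤ) - 1 then (1 : ℝ) else 0) * (((x α % (Lc : ℤ) : ℤ)) : ℝ) else 0)) l v) := by
  have h := tower_explicit hr cE cVH cΛ hαβ j (M := 1) le_rfl
  simp only [Nat.mul_one] at h
  exact h

/-- NOT IN PRINT; OUR BOOKKEEPING.  **THE SAME WITH leaf-06's `dz`-FORM OF THE EDGE POTENTIAL** (g46 `EdgePlaquettePotential`; the shape FILE E `EdgePotentialAxialGauge` consumes at level 0):
`∃ c, ∀ ν y′, C_{j+1}(ν,y′) = wVH_{j+1}·Σ'_v Σ_l wΦ_{Lc^{j+1}} ν l (y′ − v)·(c·(Π^ρ m̃_{αβ}) l v)`. -/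
theorem exists_explicit_potential_exitCharge_dz (hr : r ∈ box (d + 1) Lc) (cE cVH cΛ : ℝ) {α β : Fin (d + 1)} (hαβ : α ≠ β) (j : ℕ) :
    ∃ c : ℝ, ∀ (ν : Fin (d + 1)) (y' : Site (d + 1)), ∑' xz : Site (d + 1) × Site (d + 1),
        (if xz.1 α % (Lc : ℤ) = (Lc : ℤ) - 1 then (1 : ℝ) else 0) * (if xz.2 β % (Lc : ℤ) = (Lc : ℤ) - 1 then (1 : ℝ) else 0)
          * SpureRecAt d Lc (toSite r) cE cVH cΛ (j + 1) ν y' xz.1 xz.2 (Sum.inl α) (Sum.inl β)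
      = wVH d Lc (j + 1) * ∑' v, ∑ l : Fin (d + 1), wΦ (N := Lc ^ (j + 1)) ν l (y' - v)
          * (c * axProjAt (toSite r) Lc (fun l x => ((Lc : ℝ) ^ 2)⁻¹ * ((((x + unitVec l) β % (Lc : ℤ) : ℤ)) : ℝ) * dz (fun w : Fin (d + 1) → ℤ => ((w α : ℤ) : ℝ)) l x
              - (Lc : ℝ)⁻¹ * (((x α % (Lc : ℤ) : ℤ)) : ℝ) * dz (fun w : Fin (d + 1) → ℤ => (((w β / (Lc : ℤ) : ℤ)) : ℝ)) l x) l v) := by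
  have hLc : 1 ≤ Lc := one_le_of_neZero Lc
  have e : (fun l x => ((Lc : ℝ) ^ 2)⁻¹ * ((((x + unitVec l) β % (Lc : ℤ) : ℤ)) : ℝ) * dz (fun w : Fin (d + 1) → ℤ => ((w α : ℤ) : ℝ)) l x
        - (Lc : ℝ)⁻¹ * (((x α % (Lc : ℤ) : ℤ)) : ℝ) * dz (fun w : Fin (d + 1) → ℤ => (((w β / (Lc : ℤ) : ℤ)) : ℝ)) l x)
      = fun l x => (if l = α then ((Lc : ℝ) ^ 2)⁻¹ * (((x β % (Lc : ℤ) : ℤ)) : ℝ) else 0)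
          - (if l = β then (Lc : ℝ)⁻¹ * (if x β % (Lc : ℤ) = (Lc : ℤ) - 1 then (1 : ℝ) else 0) * (((x α % (Lc : ℤ) : ℤ)) : ℝ) else 0) := by
    funext l x
    exact edgePotential_apply hLc hαβ l x
  rw [e]
  exact exists_explicit_potential_exitCharge hr cE cVH cΛ hαβ j

end Summit.QuantumFields.BalabanUV.Beta.GAN24.ChargeTowerExplicitPotential

end
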